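import Summits.BirchSwinnertonDyer.BirchSwinnertonDyer.Theorems.SylvesterTwoHeegnerIndexUpperOffV0ShaBoundTwoOmega
import Summits.BirchSwinnertonDyer.BirchSwinnertonDyer.Theorems.SylvesterTwoHeegnerIndexUpperDescentQuadratic
import HarnessLib

/-!
# K7t crux `UpperOffV0HSYPlus` (item 19804; record twin 19581): Kolyvagin AT `p = 2` for `E_p`
# **over `ℚ`** — (d) + (e) ⟹ `2^{2M₀+4} · Ш(E_p/ℚ)[2^∞] = 0` in every Heegner frame of the route

Route `SylvesterTwoHeegnerIndex` (cell bsd-cm, rung K7t), line `offv0-kolyvagin2` (planner-registered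
variant B skeleton on stmt-BirchSwinnertonDyer-19804).  Sequel of
`…UpperOffV0ShaBoundTwoOmega` (k7t-c2 g4, p469288: the registered stub texts (d)
`stub_kolyvaginClasses_two` / (e) `stub_kolyvaginReciprocity_two` ⟹ `Ш(E_p/K)[2^∞]` finite and killed
by `2^{2M₀+4}`, `2^{M₀} ∥ P` in `E_p(K)`) and of the `K → ℚ` descent files of k7t-c2 g0
(`…UpperDescentQuadratic`, p425504: `Ш(E_p/ℚ) ↪ Ш(E_p/K′)` whenever the twin `E_p^{(d_{K′})}` has
rank `0`, resp. whenever `E_p` acquires no new rank over `K′`).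

Composing the two gives the EXPONENT form of Kolyvagin's theorem at `p = 2` for the Sylvester
curves **over `ℚ`**, i.e. in the currency of the crux (`Ш(E_p/ℚ)`), with the line's explicit defect:

* `twoPrimary_exponent_of_injective` — transport of «`q`-primary part finite and killed by `q^e`»
  along an injective additive map (pure algebra);
* `sha_two_exponent_bound_sylvester_rat_of_stubs` — (d) + (e) ⟹ for every `ℚ`-model `W` of
  `cubeSumCurve p` (`p` an odd prime), every imaginary quadratic `K` with `d_K ∉ {-3,-4}` and the
  Heegner hypothesis, every Heegner point `P ∈ E_p(K)` of infinite order, **if the twin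
  `E_p^{(d_K)}` has Mordell–Weil rank `0`** then `Ш(E_p/ℚ)[2^∞]` is finite and
  `2^{2M₀+4} · Ш(E_p/ℚ)[2^∞] = 0`, where `2^{M₀} ∥ P` in `E_p(K)`;
* `sha_two_exponent_bound_sylvester_rat_of_stubs_of_rank` — the same under «no new rank»
  `rank E_p(K) = rank E_p(ℚ)`.

In every Heegner frame of the crux the twin has rank `0` (`L(E_p^{(d_K)}, 1) ≠ 0` + GZK, named facts
of `PublishedFactsTwoPlus`, NOT used here), so this is exactly what line `offv0-kolyvagin2` delivers
over `ℚ` once (d) and (e) land: an exponent bound with defect `4`, not the crux's ORDER bound with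
defect `0` (B14 = O12 stays open as a class).  No named fact, no definition, no `sorry`.

References: [McCallumLMS1991] §1 Theorem (Kolyvagin), §§4–5; [GrossLMS1991] Thm. 1.3 (2), §2;
[SilvermanAEC2009] X.§4, Exercise 10.16.
-/

noncomputable section

open scoped Classical
open WeierstrassCurve NumberField IsDedekindDomain Field Literature.NumberTheory.EllipticCurves
  Literature.NumberTheory.EllipticCurves.HuShuYin2019 Literature.NumberTheory.GaloisRepresentations

set_option autoImplicit false
set_option linter.dupNamespace false

namespace Summit.BirchSwinnertonDyer.BirchSwinnertonDyer.Theorems.SylvesterTwoUpper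

/-! ## §1 Transport of a primary exponent bound along an injection -/

/-- **Transport of «`q`-primary part finite and killed by `q^e`» along an injective additive map.**
If `f : A →+ B` is injective and the `q`-power-torsion of `B` is finite and annihilated by `q^e`, the
same holds for `A`. [folklore] -/
theorem twoPrimary_exponent_of_injective {A B : Type*} [AddCommGroup A] [AddCommGroup B]
    (f : A →+ B) (hf : Function.Injective f) (q e : ℕ)
    (hB : ∀ b : B, (∃ j : ℕ, q ^ j • b = 0) → q ^ e • b = 0)
    (hBfin : Set.Finite {b : B | ∃ j : ℕ, q ^ j • b = 0}) :
    (∀ a : A, (∃ j : ℕ, q ^ j • a = 0) → q ^ e • a = 0) ∧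
      Set.Finite {a : A | ∃ j : ℕ, q ^ j • a = 0} := by
  have himg : ∀ a : A, (∃ j : ℕ, q ^ j • a = 0) → ∃ j : ℕ, q ^ j • f a = 0 := by
    rintro a ⟨j, hj⟩
    exact ⟨j, by rw [← map_nsmul, hj, map_zero]⟩
  refine ⟨fun a ha => ?_, ?_⟩
  · apply hf
    rw [map_nsmul, map_zero]
    exact hB (f a) (himg a ha)
  · refine Set.Finite.of_finite_image (f := f) ?_ hf.injOn
    exact hBfin.subset (by
      rintro _ ⟨a, ha, rfl⟩
      exact himg a ha)

/-! ## §2 (d) + (e) ⟹ `2^{2M₀+4} Ш(E_p/ℚ)[2^∞] = 0` -/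

/-- **Kolyvagin at `p = 2` for the Sylvester curves, over `ℚ`, exponent form with the line's
defect** (twin-rank-zero frame).  Granted the registered stub texts (d) `stub_kolyvaginClasses_two`
(binder `hD`) and (e) `stub_kolyvaginReciprocity_two` (binder `hE`) of line `offv0-kolyvagin2`
VERBATIM: for every `ℚ`-model `W` of `cubeSumCurve p` (`p` an odd prime), every imaginary quadratic
`K` with `d_K ∉ {-3, -4}` satisfying the Heegner hypothesis for `N`, every Heegner point `P ∈ E_p(K)`
of level `N` of infinite order, if the quadratic twist `E_p^{(d_K)}` has Mordell–Weil rank `0`, then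
with `2^{M₀} ∥ P` in `E_p(K)`: `Ш(E_p/ℚ)[2^∞]` is finite and `2^{2M₀+4} · Ш(E_p/ℚ)[2^∞] = 0`.
Proof: `sha_two_exponent_bound_sylvester_of_stubs'` over `K`, transported along the injection
`Ш(E_p/ℚ) ↪ Ш(E_p/K)` (`shaRestriction_injective_sylvester_of_twist_rank_zero`).
[cite: McCallumLMS1991, §1 Theorem (Kolyvagin)] [cite: GrossLMS1991, Thm. 1.3 (2), §2] -/
theorem sha_two_exponent_bound_sylvester_rat_of_stubs
    (hD : ∀ (N : ℕ) [NeZero N] (W : WeierstrassCurve ℚ) [W.IsElliptic] (K : Type) [Field K]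
      [NumberField K] (_hK : IsImaginaryQuadratic K)
      (_hD : NumberField.discr K ≠ -3 ∧ NumberField.discr K ≠ -4)
      (_hH : SatisfiesHeegnerHypothesis N K) {P : (W.baseChange K).toAffine.Point}
      (_hP : IsHeegnerPoint N W K P) (_hnt : ¬ IsOfFinAddOrder P) {M : ℕ} (_hM : 1 ≤ M)
      (hdiv : ∀ Q : geomPoints (W.baseChange K), ∃ R, ((2 ^ M : ℕ) : ℤ) • R = Q)
      (c : K ≃ₐ[ℚ] K) (_hc : c ≠ 1),
      ∃ (ε : ℤ) (τ : AlgebraicClosure K ≃+* AlgebraicClosure K) (hτ : IsLiftOfAut c τ)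
        (A : ℕ → AddSubgroup (geomPoints (W.baseChange K)))
        (hA : ∀ m, KolyvaginCocycle.IsAdmissible (Field.absoluteGaloisGroup K) (A m)
          ((2 ^ M : ℕ) : ℤ))
        (Pt : ℕ → geomPoints (W.baseChange K))
        (hPt : ∀ m, Pt m ∈
          KolyvaginCocycle.invPoints (Field.absoluteGaloisGroup K) (A m) ((2 ^ M : ℕ) : ℤ)),
        (ε = 1 ∨ ε = -1) ∧
        IsOfFinAddOrder (Affine.Point.map (W' := W) (c : K →ₐ[ℚ] K) P - ε • P) ∧
        (∀ m, ∀ a ∈ A m, hτ.pointsMap W a ∈ A m) ∧ Pt 1 = toGeomPoints (W.baseChange K) P ∧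
        (∀ m : ℕ, Squarefree m →
          (∀ q ∈ m.primeFactors, IsKolyvaginPrime N W K 2 q ∧ FrobEqFrobInfty W K (2 ^ M) q) →
          (∃ B ∈ A m, hτ.pointsMap W (Pt m) =
            (ε * (-1) ^ m.primeFactors.card) • Pt m + ((2 ^ M : ℕ) : ℤ) • B) ∧
          (∀ v : HeightOneSpectrum (𝓞 K), (m : 𝓞 K) ∉ v.asIdeal →
            kolyvaginClass (W.baseChange K) _ hdiv (hA m) (Pt m) (hPt m) ∈
              selmerLocalKer (W.baseChange K) (v.adicCompletion K) ((2 ^ M : ℕ) : ℤ)) ∧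
          (∀ ℓ : ℕ, ℓ.Prime → ℓ ∣ m → ∀ v : HeightOneSpectrum (𝓞 K), (ℓ : 𝓞 K) ∈ v.asIdeal →
            ∀ a : ℕ, ((((2 : ℕ) : ℤ) ^ a) •
                kolyvaginClass (W.baseChange K) _ hdiv (hA m) (Pt m) (hPt m) ∈
                selmerLocalKer (W.baseChange K) (v.adicCompletion K) ((2 ^ M : ℕ) : ℤ) ↔
              (((2 : ℕ) : ℤ) ^ a) • kolyvaginClass (W.baseChange K) _ hdiv (hA (m / ℓ))
                  (Pt (m / ℓ)) (hPt (m / ℓ)) ∈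
                (W.baseChange K).torsionLocalKer (v.adicCompletion K) ((2 ^ M : ℕ) : ℤ)))))
    (hE : ∀ (N : ℕ) [NeZero N] (W : WeierstrassCurve ℚ) [W.IsElliptic] (K : Type) [Field K]
      [NumberField K] (_hK : IsImaginaryQuadratic K)
      (_hD : NumberField.discr K ≠ -3 ∧ NumberField.discr K ≠ -4)
      (_hH : SatisfiesHeegnerHypothesis N K) {P : (W.baseChange K).toAffine.Point}
      (_hP : IsHeegnerPoint N W K P) (_hnt : ¬ IsOfFinAddOrder P) {M : ℕ} (_hM : 1 ≤ M) {ℓ : ℕ}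
      (hℓ : IsKolyvaginPrime N W K 2 ℓ), FrobEqFrobInfty W K (2 ^ M) ℓ →
      ∃ (A : Type) (_ : AddCommGroup A)
        (e : geomTorsion (W.baseChange K) ((2 ^ M : ℕ) : ℤ) →+
          geomTorsion (W.baseChange K) ((2 ^ M : ℕ) : ℤ) →+ A),
        (∀ x, e x x = 0) ∧ (∀ x, (∀ y, e x y = 0) → x = 0) ∧
        ∀ s ∈ selmerGroup (W.baseChange K) ((2 ^ M : ℕ) : ℤ),
          ∀ c' : galH1Torsion (W.baseChange K) ((2 ^ M : ℕ) : ℤ),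
          (∀ v : HeightOneSpectrum (𝓞 K), (ℓ : 𝓞 K) ∉ v.asIdeal →
            c' ∈ selmerLocalKer (W.baseChange K) (v.adicCompletion K) ((2 ^ M : ℕ) : ℤ)) →
          (∀ w : InfinitePlace K,
            c' ∈ selmerLocalKer (W.baseChange K) w.Completion ((2 ^ M : ℕ) : ℤ)) →
          ∀ 𝔔 ∈ hℓ.place.primesAbove, ∀ F : Field.absoluteGaloisGroup K,
            IsArithFrobAt (𝓞 K) F 𝔔 → F ∈ torsionFixing (W.baseChange K) ((2 ^ M : ℕ) : ℤ) →
            ∀ σ ∈ 𝔔.inertia (Field.absoluteGaloisGroup K),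
            e (h1Eval (W.baseChange K) ((2 ^ M : ℕ) : ℤ) s F)
              (h1Eval (W.baseChange K) ((2 ^ M : ℕ) : ℤ) c' σ) = 0)
    {p : ℕ} (hp : p.Prime) (hp2 : p ≠ 2) {N : ℕ} [NeZero N] (W : WeierstrassCurve ℚ) [W.IsElliptic]
    (hW : ∃ C : VariableChange ℚ, C • W = HuShuYin2019.cubeSumCurve (p : ℚ))
    {K : Type} [Field K] [NumberField K] (hK : IsImaginaryQuadratic K)
    (hdK : NumberField.discr K ≠ -3 ∧ NumberField.discr K ≠ -4) (hH : SatisfiesHeegnerHypothesis N K)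
    {P : (W.baseChange K).toAffine.Point} (hP : IsHeegnerPoint N W K P) (hnt : ¬ IsOfFinAddOrder P)
    (htwist : (W.quadraticTwist (NumberField.discr K : ℚ)).mordellWeilRank = 0) :
    ∃ (M₀ : ℕ) (x₀ : (W.baseChange K).toAffine.Point),
      2 ^ M₀ • x₀ = P ∧ (∀ Q : (W.baseChange K).toAffine.Point, 2 ^ (M₀ + 1) • Q ≠ P) ∧
      (∀ cs : W.sha, (∃ j : ℕ, 2 ^ j • cs = 0) → 2 ^ (2 * M₀ + 4) • cs = 0) ∧
      Set.Finite {cs : W.sha | ∃ j : ℕ, 2 ^ j • cs = 0} := by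
  obtain ⟨M₀, x₀, hx₀, hmax, hkill, hfin⟩ :=
    sha_two_exponent_bound_sylvester_of_stubs' hD hE hp hp2 W hW hK hdK hH hP hnt
  have hinj : Function.Injective (shaRestriction W K) :=
    shaRestriction_injective_sylvester_of_twist_rank_zero hp hp2 W hW K hK.1 htwist
  obtain ⟨hkillQ, hfinQ⟩ :=
    twoPrimary_exponent_of_injective (shaRestriction W K) hinj 2 (2 * M₀ + 4) hkill hfin
  exact ⟨M₀, x₀, hx₀, hmax, hkillQ, hfinQ⟩

/-- **Kolyvagin at `p = 2` for the Sylvester curves, over `ℚ`, exponent form with the line's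
defect** (no-new-rank frame): as `sha_two_exponent_bound_sylvester_rat_of_stubs`, with the frame
hypothesis stated as `rank E_p(K) = rank E_p(ℚ)` (the Mordell–Weil form; in a Heegner frame of the
route the two forms agree by `rank E(K) = rank E(ℚ) + rank E^{(d_K)}(ℚ)`).  Transport along
`shaRestriction_injective_sylvester_quadratic`.
[cite: McCallumLMS1991, §1 Theorem (Kolyvagin)] [cite: GrossLMS1991, Thm. 1.3 (2), §2] -/
theorem sha_two_exponent_bound_sylvester_rat_of_stubs_of_rank
    (hD : ∀ (N : ℕ) [NeZero N] (W : WeierstrassCurve ℚ) [W.IsElliptic] (K : Type) [Field K]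
      [NumberField K] (_hK : IsImaginaryQuadratic K)
      (_hD : NumberField.discr K ≠ -3 ∧ NumberField.discr K ≠ -4)
      (_hH : SatisfiesHeegnerHypothesis N K) {P : (W.baseChange K).toAffine.Point}
      (_hP : IsHeegnerPoint N W K P) (_hnt : ¬ IsOfFinAddOrder P) {M : ℕ} (_hM : 1 ≤ M)
      (hdiv : ∀ Q : geomPoints (W.baseChange K), ∃ R, ((2 ^ M : ℕ) : ℤ) • R = Q)
      (c : K ≃ₐ[ℚ] K) (_hc : c ≠ 1),
      ∃ (ε : ℤ) (τ : AlgebraicClosure K ≃+* AlgebraicClosure K) (hτ : IsLiftOfAut c τ)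
        (A : ℕ → AddSubgroup (geomPoints (W.baseChange K)))
        (hA : ∀ m, KolyvaginCocycle.IsAdmissible (Field.absoluteGaloisGroup K) (A m)
          ((2 ^ M : ℕ) : ℤ))
        (Pt : ℕ → geomPoints (W.baseChange K))
        (hPt : ∀ m, Pt m ∈
          KolyvaginCocycle.invPoints (Field.absoluteGaloisGroup K) (A m) ((2 ^ M : ℕ) : ℤ)),
        (ε = 1 ∨ ε = -1) ∧
        IsOfFinAddOrder (Affine.Point.map (W' := W) (c : K →ₐ[ℚ] K) P - ε • P) ∧
        (∀ m, ∀ a ∈ A m, hτ.pointsMap W a ∈ A m) ∧ Pt 1 = toGeomPoints (W.baseChange K) P ∧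
        (∀ m : ℕ, Squarefree m →
          (∀ q ∈ m.primeFactors, IsKolyvaginPrime N W K 2 q ∧ FrobEqFrobInfty W K (2 ^ M) q) →
          (∃ B ∈ A m, hτ.pointsMap W (Pt m) =
            (ε * (-1) ^ m.primeFactors.card) • Pt m + ((2 ^ M : ℕ) : ℤ) • B) ∧
          (∀ v : HeightOneSpectrum (𝓞 K), (m : 𝓞 K) ∉ v.asIdeal →
            kolyvaginClass (W.baseChange K) _ hdiv (hA m) (Pt m) (hPt m) ∈
              selmerLocalKer (W.baseChange K) (v.adicCompletion K) ((2 ^ M : ℕ) : ℤ)) ∧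
          (∀ ℓ : ℕ, ℓ.Prime → ℓ ∣ m → ∀ v : HeightOneSpectrum (𝓞 K), (ℓ : 𝓞 K) ∈ v.asIdeal →
            ∀ a : ℕ, ((((2 : ℕ) : ℤ) ^ a) •
                kolyvaginClass (W.baseChange K) _ hdiv (hA m) (Pt m) (hPt m) ∈
                selmerLocalKer (W.baseChange K) (v.adicCompletion K) ((2 ^ M : ℕ) : ℤ) ↔
              (((2 : ℕ) : ℤ) ^ a) • kolyvaginClass (W.baseChange K) _ hdiv (hA (m / ℓ))
                  (Pt (m / ℓ)) (hPt (m / ℓ)) ∈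
                (W.baseChange K).torsionLocalKer (v.adicCompletion K) ((2 ^ M : ℕ) : ℤ)))))
    (hE : ∀ (N : ℕ) [NeZero N] (W : WeierstrassCurve ℚ) [W.IsElliptic] (K : Type) [Field K]
      [NumberField K] (_hK : IsImaginaryQuadratic K)
      (_hD : NumberField.discr K ≠ -3 ∧ NumberField.discr K ≠ -4)
      (_hH : SatisfiesHeegnerHypothesis N K) {P : (W.baseChange K).toAffine.Point}
      (_hP : IsHeegnerPoint N W K P) (_hnt : ¬ IsOfFinAddOrder P) {M : ℕ} (_hM : 1 ≤ M) {ℓ : ℕ}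
      (hℓ : IsKolyvaginPrime N W K 2 ℓ), FrobEqFrobInfty W K (2 ^ M) ℓ →
      ∃ (A : Type) (_ : AddCommGroup A)
        (e : geomTorsion (W.baseChange K) ((2 ^ M : ℕ) : ℤ) →+
          geomTorsion (W.baseChange K) ((2 ^ M : ℕ) : ℤ) →+ A),
        (∀ x, e x x = 0) ∧ (∀ x, (∀ y, e x y = 0) → x = 0) ∧
        ∀ s ∈ selmerGroup (W.baseChange K) ((2 ^ M : ℕ) : ℤ),
          ∀ c' : galH1Torsion (W.baseChange K) ((2 ^ M : ℕ) : ℤ),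
          (∀ v : HeightOneSpectrum (𝓞 K), (ℓ : 𝓞 K) ∉ v.asIdeal →
            c' ∈ selmerLocalKer (W.baseChange K) (v.adicCompletion K) ((2 ^ M : ℕ) : ℤ)) →
          (∀ w : InfinitePlace K,
            c' ∈ selmerLocalKer (W.baseChange K) w.Completion ((2 ^ M : ℕ) : ℤ)) →
          ∀ 𝔔 ∈ hℓ.place.primesAbove, ∀ F : Field.absoluteGaloisGroup K,
            IsArithFrobAt (𝓞 K) F 𝔔 → F ∈ torsionFixing (W.baseChange K) ((2 ^ M : ℕ) : ℤ) →
            ∀ σ ∈ 𝔔.inertia (Field.absoluteGaloisGroup K),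
            e (h1Eval (W.baseChange K) ((2 ^ M : ℕ) : ℤ) s F)
              (h1Eval (W.baseChange K) ((2 ^ M : ℕ) : ℤ) c' σ) = 0)
    {p : ℕ} (hp : p.Prime) (hp2 : p ≠ 2) {N : ℕ} [NeZero N] (W : WeierstrassCurve ℚ) [W.IsElliptic]
    (hW : ∃ C : VariableChange ℚ, C • W = HuShuYin2019.cubeSumCurve (p : ℚ))
    {K : Type} [Field K] [NumberField K] (hK : IsImaginaryQuadratic K)
    (hdK : NumberField.discr K ≠ -3 ∧ NumberField.discr K ≠ -4) (hH : SatisfiesHeegnerHypothesis N K)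
    {P : (W.baseChange K).toAffine.Point} (hP : IsHeegnerPoint N W K P) (hnt : ¬ IsOfFinAddOrder P)
    (hrank : (W.baseChange K).mordellWeilRank = W.mordellWeilRank) :
    ∃ (M₀ : ℕ) (x₀ : (W.baseChange K).toAffine.Point),
      2 ^ M₀ • x₀ = P ∧ (∀ Q : (W.baseChange K).toAffine.Point, 2 ^ (M₀ + 1) • Q ≠ P) ∧
      (∀ cs : W.sha, (∃ j : ℕ, 2 ^ j • cs = 0) → 2 ^ (2 * M₀ + 4) • cs = 0) ∧
      Set.Finite {cs : W.sha | ∃ j : ℕ, 2 ^ j • cs = 0} := by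
  obtain ⟨M₀, x₀, hx₀, hmax, hkill, hfin⟩ :=
    sha_two_exponent_bound_sylvester_of_stubs' hD hE hp hp2 W hW hK hdK hH hP hnt
  have hinj : Function.Injective (shaRestriction W K) :=
    shaRestriction_injective_sylvester_quadratic hp hp2 W hW K hK.1 hrank
  obtain ⟨hkillQ, hfinQ⟩ :=
    twoPrimary_exponent_of_injective (shaRestriction W K) hinj 2 (2 * M₀ + 4) hkill hfin
  exact ⟨M₀, x₀, hx₀, hmax, hkillQ, hfinQ⟩

end Summit.BirchSwinnertonDyer.BirchSwinnertonDyer.Theorems.SylvesterTwoUpper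

end
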